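import Mathlib

/-!
# [OURS · L1 W4.5(b) · EL♮(3) · IDEATOR 1 · ROUND 17] Key-polynomial letters, part 2:
# the key letter HOSTS every centre of the word (chart identities), its ORDERS along the two immature centres
# (the equimultiplicity data of T-M1-EXACT), the GAUGE lemma «lifts of coordinates are coordinates», and the
# characteristic-2 degeneration of the du Val letter

Companion of `Cruxes/EquisingularLiftNatThree/KeyPolynomialLettersR16.lean` (res-L1-w45b-idea-1 g25, sha16 4a3ce5306325ac12).
Crux item stmt-ResolutionOfSingularities-20148 (`EquisingularLiftNatThree`), idea card `toric-towers` §ROUND 17.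
OURS; NOT a statement of any manuscript ([Hironaka2017] is a candidate under adjudication, nothing of it is asserted);
AI-written, weaker than expert review; EL♮(3) is NOT proved here or anywhere. `import Mathlib` only; no `sorry`.

SETTING (S10 = `(x²+y²z)² + x⁵ + z⁶ + xy⁸ + x¹⁰ + y¹⁰ + z¹⁰`, key letter `M = V(x² + y²z + z³)`, word of record
`P · CAR(S, St Π) · pair(E₁, St Λ)@φ̃_q · pair(E₁, St S)@σ_S · pair(E_φ, St⁴M)@σ∗`, `Π = V(x)`, `Λ = V(x+z)`; charts named as in
res-L1-w45b-lead-1's atlas `m7/atlas7.sage`: `S.y` = point chart keeping `y`, `E1.x` = chart of the blow-up along `{x=y=0}` keeping `x`,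
`Ephi.z` / `Ephi.x` = charts of the blow-up along `{x=z=0}`, `EsS.x` / `EsS.y` = charts of the blow-up along `{x=y=0}`).

CONTENT (every identity over an arbitrary commutative ring, hence simultaneously over the lift ring `O`, its residue field `k`
and its fraction field — this is what «the upstairs tower in the engine's gauge is the verbatim tower» uses):
* §H HOST identities: at every move the local equation of the current strict transform of `M` lies in the ideal of the centre,
  with the stated lowest form — `M ∈ (x,y,z)²` (form `x²`), `St¹M = x·x + (z+z³)·y ∈ 𝓘(L̃) = (x,y)` (ORDER ONE along the carrier line,
  lowest form `(z+z³)·y`, jumping exactly at `z(1+z²) = 0` = the three A₁ points), `St²M ∈ 𝓘(φ̃_q) = (x,z)` and `∈ 𝓘(σ_S) = (x,y)`,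
  `St³M ∈ 𝓘(σ_S)`, `St⁴M ∈ 𝓘(σ∗)` in both charts, together with the total-transform factorisations `total = exc^{ord} · strict`
  for the three mature rounds (orders `1, 1, 1`: the letter CONTAINS each centre);
* §E the two EQUIMULTIPLICITY witnesses in the shape of the hypotheses `hΦ`/`hΦb` of the tree's T-M1-EXACT
  `map_blowupAlgebraMap_strictTransformIdeal_eq` (…NatEquimultipleStrictTransform, ✓ p515745): the degree-2 form `X₀²` of the point step
  and the degree-1 form `(z+z³)·Y` of the carrier round are non-zero modulo the centre over ANY non-trivial coefficient ring (so over `k`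
  of every characteristic and over `O`): the exact-special-fibre transport of the IMMATURE letter needs nothing characteristic-dependent;
* §G GAUGE: over a local ring a square matrix whose reduction to the residue field is invertible (e.g. reduces to `1`) is invertible —
  the models `ℓ̃_Π, ℓ̃_Y, ℓ̃_Λ − ℓ̃_Π` of hyperplane letters through the section, which reduce to the coordinates `x, y, z`, ARE homogeneous
  coordinates over `O`, and the key letter's model `M_O := ℓ̃_Π² + ℓ̃_Y²(ℓ̃_Λ − ℓ̃_Π) + (ℓ̃_Λ − ℓ̃_Π)³` is the verbatim du Val polynomial in them;
* §C the characteristic-2 degeneration: if `2 = 0` the du Val letter `x² + y²z + z³` is singular along the whole line `{x = 0, y = z}`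
  (all partials and the equation vanish at `(0,t,t)`), so the design rule's decidable test must pick another monomial at `p = 2`
  (kit j315968, card §R17-3).
[cite: GortzWedhorn2020, (13.19) and Prop. 13.96 (2)] [cite: Matsumura1987, Thm. 14.2] — through the cited tree file only; the identities
below are elementary algebra.
-/

set_option linter.dupNamespace false -- mandated namespace `Summit.<Summit>.<Problem>` of this single-conjunct summit

namespace Summit.ResolutionOfSingularities.ResolutionOfSingularities.Cruxes.EquisingularLiftNatThree.ToricTowers.R17

section Host
variable {A : Type*} [CommRing A]

/-! ### §H  The key letter hosts every centre of the word -/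

/-- Move `P` (centre `x₀ = V(x,y,z)`): `M ∈ (x,y,z)²`, degree-2 form `x²`, remainder `y²z + z³ ∈ (x,y,z)³`. -/
theorem host_P (x y z : A) : x ^ 2 + y ^ 2 * z + z ^ 3 = x * x + (y * (y * z) + z * (z * z)) := by ring

/-- Move `P`, chart `S.y` (`(x,y,z) ↦ (xy, y, zy)`): total transform `= y² · St¹M`, `St¹M = x² + yz + yz³` (order of `M` along the
section is EXACTLY 2: the R16 identity `duVal_P_Sy`, restated for self-containedness). -/
theorem total_P_Sy (x y z : A) : (x * y) ^ 2 + y ^ 2 * (z * y) + (z * y) ^ 3 = y ^ 2 * (x ^ 2 + y * z + y * z ^ 3) := by ring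

/-- Move `CAR` (centre the carrier line `L̃ = S ∩ St Π = V(y, x)` in chart `S.y`): `St¹M = x·x + (z+z³)·y ∈ (x, y)` — the letter CONTAINS
the centre, with ORDER ONE along it and lowest form `(z + z³)·y`. -/
theorem host_CAR_Sy (x y z : A) : x ^ 2 + y * z + y * z ^ 3 = x * x + (z + z ^ 3) * y := by ring

/-- The lowest coefficient `z + z³ = z(1 + z²)` vanishes exactly at the three A₁ points `z = 0`, `z² = −1` of `St¹M` on `L̃`
(the order of `St¹M` along `L̃` jumps from 1 to 2 there and only there). -/
theorem car_lowest_coeff_factor (z : A) : z + z ^ 3 = z * (1 + z ^ 2) := by ring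

/-- Move `CAR`, chart `S.y/E1.x` (`y ↦ yx`): total `= x¹ · St²M`, `St²M = x + yz + yz³` (R16 `duVal_CAR_Sy_E1x`). -/
theorem total_CAR_Sy_E1x (x y z : A) : x ^ 2 + (y * x) * z + (y * x) * z ^ 3 = x * (x + y * z + y * z ^ 3) := by ring

/-- Move `φ̃_q` (centre `E₁ ∩ St Λ = V(x, z)` in chart `S.y/E1.x`): `St²M = x + (y + yz²)·z ∈ (x, z)` — the (now regular) letter contains
the centre, order one. -/
theorem host_phi_Sy_E1x (x y z : A) : x + y * z + y * z ^ 3 = x + (y + y * z ^ 2) * z := by ring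

/-- Move `σ_S` seen from stage 2 (centre `E₁ ∩ St S = V(x, y)` in chart `S.y/E1.x`): `St²M = x + (z + z³)·y ∈ (x, y)`. -/
theorem host_sigmaS_Sy_E1x (x y z : A) : x + y * z + y * z ^ 3 = x + (z + z ^ 3) * y := by ring

/-- Round at `φ̃_q`, chart `Ephi.z` (`x ↦ xz`): total `= z¹ · St³M`, `St³M = x + y + yz²`. -/
theorem total_PHI_Ephiz (x y z : A) : x * z + y * z + y * z ^ 3 = z * (x + y + y * z ^ 2) := by ring

/-- Round at `φ̃_q`, chart `Ephi.x` (`z ↦ zx`): total `= x¹ · St³M'`, `St³M' = 1 + yz + x²yz³`. -/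
theorem total_PHI_Ephix (x y z : A) : x + y * (z * x) + y * (z * x) ^ 3 = x * (1 + y * z + x ^ 2 * y * z ^ 3) := by ring

/-- Move `σ_S` (centre `V(y, x+y)` in chart `Ephi.z`): `St³M = (x+y) + z²·y ∈ (x+y, y)` — order one. -/
theorem host_sigmaS_Ephiz (x y z : A) : x + y + y * z ^ 2 = (x + y) + z ^ 2 * y := by ring

/-- `σ∗ = E_φ ∩ St M = V(x, 1 + yz)` in chart `Ephi.x` (before and after the `σ_S` round, which does not meet this chart):
`St³M' = (1 + yz) + x·(xyz³) ∈ (x, 1+yz)`. -/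
theorem host_sigmaStar_Ephix (x y z : A) : 1 + y * z + x ^ 2 * y * z ^ 3 = (1 + y * z) + x * (x * y * z ^ 3) := by ring

/-- Round at `σ_S`, chart `Ephi.z/EsS.x` (`y ↦ yx`): total `= x¹ · St⁴M`, `St⁴M = 1 + y + yz²`. -/
theorem total_SIGS_Ephiz_EsSx (x y z : A) : x + y * x + (y * x) * z ^ 2 = x * (1 + y + y * z ^ 2) := by ring

/-- Round at `σ_S`, chart `Ephi.z/EsS.y` (`x ↦ xy`): total `= y¹ · St⁴M'`, `St⁴M' = x + 1 + z²`. -/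
theorem total_SIGS_Ephiz_EsSy (x y z : A) : x * y + y + y * z ^ 2 = y * (x + 1 + z ^ 2) := by ring

/-- Move `σ∗` (centre `E_φ ∩ St⁴M = V(z, 1+y)` in chart `Ephi.z/EsS.x`): `St⁴M = (1+y) + z·(yz) ∈ (z, 1+y)`. -/
theorem host_sigmaStar_EsSx (y z : A) : 1 + y + y * z ^ 2 = (1 + y) + z * (y * z) := by ring

/-- Move `σ∗` in chart `Ephi.z/EsS.y`: `St⁴M' = (x+1) + z·z ∈ (z, x+1)`. -/
theorem host_sigmaStar_EsSy (x z : A) : x + 1 + z ^ 2 = (x + 1) + z * z := by ring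

end Host

section Equimultiplicity

/-! ### §E  The equimultiplicity witnesses (hypotheses `hΦ` / `hΦb` of T-M1-EXACT) are characteristic-free -/

/-- Point step: the degree-2 form of `M` along the section is `X₀²`, non-zero over every non-trivial coefficient ring
(in particular modulo the maximal ideal of `O`, i.e. over `k` of any characteristic): `ord_{x₀} M = ord_s M_O = 2`. -/
theorem pointStep_form_ne_zero (k : Type*) [CommRing k] [Nontrivial k] :
    (MvPolynomial.X (0 : Fin 3) ^ 2 : MvPolynomial (Fin 3) k) ≠ 0 := by
  rw [MvPolynomial.X_pow_eq_monomial]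
  exact fun h => one_ne_zero (MvPolynomial.monomial_eq_zero.mp h)

/-- Carrier round: the lowest coefficient of `St¹M` along `L̃` is the polynomial `z³ + z` in the curve parameter, MONIC, hence non-zero
over every non-trivial coefficient ring — `St¹M` has generic order EXACTLY one along `L̃` downstairs in every characteristic (and upstairs),
which is T-M1-EXACT's equimultiplicity hypothesis for the curve centre (`r = 2`). -/
theorem carrierRound_lowest_monic (k : Type*) [CommRing k] :
    (Polynomial.X ^ 3 + Polynomial.X : Polynomial k).Monic :=
  Polynomial.monic_X_pow_add (p := (Polynomial.X : Polynomial k)) (n := 3)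
    ((Polynomial.degree_X_le (R := k)).trans_lt (by exact_mod_cast (by norm_num : (1 : ℕ) < 3)))

theorem carrierRound_lowest_ne_zero (k : Type*) [CommRing k] [Nontrivial k] :
    (Polynomial.X ^ 3 + Polynomial.X : Polynomial k) ≠ 0 :=
  (carrierRound_lowest_monic k).ne_zero

end Equimultiplicity

section Gauge

/-! ### §G  Gauge: lifts of coordinates are coordinates -/

variable {O : Type*} [CommRing O] [IsLocalRing O] {n : Type*} [Fintype n] [DecidableEq n]

/-- Over a local ring, an element whose residue class is a unit is a unit. -/
theorem isUnit_of_isUnit_residue {a : O} (h : IsUnit (IsLocalRing.residue O a)) : IsUnit a := by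
  by_contra ha
  have hm : a ∈ IsLocalRing.maximalIdeal O := (IsLocalRing.mem_maximalIdeal a).mpr ha
  have h0 : IsLocalRing.residue O a = 0 := (IsLocalRing.residue_eq_zero_iff a).mpr hm
  exact not_isUnit_zero (h0 ▸ h)

/-- **Gauge lemma.** A square matrix over a local ring whose reduction to the residue field has invertible determinant is invertible:
lifts `ℓ̃ᵢ` of a system of homogeneous coordinates of `ℙⁿ_k` form a system of homogeneous coordinates of `ℙⁿ_O`. -/
theorem isUnit_det_of_isUnit_det_residue (M : Matrix n n O)
    (h : IsUnit (M.map (IsLocalRing.residue O)).det) : IsUnit M.det := by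
  have hdet : IsLocalRing.residue O M.det = (M.map (IsLocalRing.residue O)).det := by
    rw [RingHom.map_det]; rfl
  exact isUnit_of_isUnit_residue (hdet ▸ h)

theorem isUnit_of_isUnit_det_residue (M : Matrix n n O)
    (h : IsUnit (M.map (IsLocalRing.residue O)).det) : IsUnit M :=
  (Matrix.isUnit_iff_isUnit_det M).mpr (isUnit_det_of_isUnit_det_residue M h)

/-- The case used for key letters: the models reduce to the coordinates themselves (reduction of the coefficient matrix `= 1`). -/
theorem isUnit_of_residue_eq_one (M : Matrix n n O) (h : M.map (IsLocalRing.residue O) = 1) : IsUnit M :=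
  isUnit_of_isUnit_det_residue M (by rw [h, Matrix.det_one]; exact isUnit_one)

end Gauge

section CharTwo

/-! ### §C  Characteristic 2: the du Val letter degenerates -/

variable {A : Type*} [CommRing A]

/-- If `2 = 0` in `A` then at every point `(0, t, t)` the du Val polynomial `x² + y²z + z³` and its three partial derivatives
`2x`, `2yz`, `y² + 3z²` vanish: the letter is singular along the whole line `{x = 0, y = z}` through `x₀` (no isolated D₄ point in
characteristic 2), so the R16 design rule must choose another monomial there. -/
theorem duVal_charTwo_singular_line (h2 : (2 : A) = 0) (t : A) :
    (0 : A) ^ 2 + t ^ 2 * t + t ^ 3 = 0 ∧ 2 * (0 : A) = 0 ∧ 2 * t * t = 0 ∧ t ^ 2 + 3 * t ^ 2 = 0 := by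
  have h4 : (4 : A) = 0 := by
    have : (4 : A) = 2 * 2 := by norm_num
    rw [this, h2, mul_zero]
  refine ⟨?_, by ring, ?_, ?_⟩
  · have : (0 : A) ^ 2 + t ^ 2 * t + t ^ 3 = 2 * t ^ 3 := by ring
    rw [this, h2, zero_mul]
  · rw [h2, zero_mul, zero_mul]
  · have : t ^ 2 + 3 * t ^ 2 = 4 * t ^ 2 := by ring
    rw [this, h4, zero_mul]

end CharTwo

end Summit.ResolutionOfSingularities.ResolutionOfSingularities.Cruxes.EquisingularLiftNatThree.ToricTowers.R17
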